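import Literature.Geometry.Symplectic.SphereCROperatorLinearisation
import Literature.Analysis.Calculus.SmoothImplicitFunctionLocal
import HarnessLib

/-!
# The implicit-function family of chart solutions (level `k`)

Layer B5 of the analytic core of the Hofer–Lizan–Sikorav local foliation theorem (Wendl 2018,
Thm. 2.46; lead of crux `WitnessCharge`, summit `SmoothPoincare4`). For chart data
`𝒥 : SphereACData` and `k ≥ 1` we apply the smooth local implicit function theorem
(`exists_smooth_implicitFunction_of_contDiffOn'`) to the map

  `G (a, y) = ((FT y, FN y), (slice₃ y.1, y.2(0) - a)) : ℂ × SecPair k r → (𝓗T' × 𝓗N') × ((ℂ³) × ℂ)`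

(`SphereCROperatorLinearisation.lean`): `G (0, 0) = 0`, `G` is `C^∞` on `ℂ × {small}`, and its
partial derivative in `y` at `(0, 0)` is the bordered isomorphism `linEquiv`
(`fderiv_Gmap_comp_inr`). The result (`exists_family`) is `ε, δ > 0` and a `C^∞` map
`γ : ball 0 ε → SecPair k r`, `γ 0 = 0`, such that for `‖a‖ < ε` the pair `γ a = (ξₐ, fₐ)` is small,
solves the chart Cauchy–Riemann equations (`FT = FN = 0`), has vanishing tangential slice
`slice₃ ξₐ = 0`, and satisfies the border condition `fₐ(0) = a`; `γ a` is the unique such small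
`y` in `ball 0 δ`. Consequences: `out₀ (γ a) = out₁ (γ a) = 0` (`out₀_eq_zero_of_FT_FN`), hence
`crOp₀ (sec₀ ξₐ) (sec₀ fₐ) z = 0` for `‖z‖ < 3` (`crOp₀_eq_zero_of_out₀`), and, where the
transport is invertible, the Cauchy–Riemann expression itself vanishes
(`crExpr_eq_zero_of_crOp₀`).

## References

* C. Wendl, *Holomorphic Curves in Low Dimensions*, LNM 2216 (2018), §2.3, Thm. 2.46. [Wendl2018]
-/

noncomputable section

open Set Filter Metric Function Complex
open scoped Topology NNReal ContDiff
open Literature.Analysis.FunctionSpaces Literature.Analysis.Complex.RiemannSphere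
open Literature.Analysis.Complex.ProjectiveLineExpChart Literature.Geometry.Symplectic.CRExpression
open Literature.Analysis.Complex Literature.Analysis.Calculus

namespace Literature.Geometry.Symplectic

namespace SphereCR

namespace SphereACData

variable (𝒥 : SphereACData) {r : ℝ≥0} (hr : r ≤ 1) (k : ℕ)

/-! ### The implicit-function map -/

/-- **The implicit-function map** `G (a, y) = ((FT y, FN y), (slice₃ y.1, y.2(0) - a))`.
[cite: Wendl2018, Thm. 2.46] -/
def Gmap (p : ℂ × SecPair k r) :
    (holderSections ℂ (dbarClutch (fun w : ℂ => -w ^ 2)) k r ×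
      holderSections ℂ (dbarClutch (1 : ℂ → ℂ)) k r) × ((ℂ × ℂ × ℂ) × ℂ) :=
  ((𝒥.FT hr k p.2, 𝒥.FN hr k p.2),
    (slice₃ (k + 1) r p.2.1, eval₀CLM (F := ℂ) (1 : ℂ → ℂ) (k + 1) r 0 p.2.2 - p.1))

/-- `G (0, 0) = 0`. [folklore] -/
theorem Gmap_zero : 𝒥.Gmap hr k (0, 0) = 0 := by
  simp only [Gmap, Prod.snd_zero, Prod.fst_zero, 𝒥.FT_zero, 𝒥.FN_zero, map_zero, sub_zero,
    Prod.mk_zero_zero]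

/-- `G` is `C^∞` on `ℂ × {small}`. [folklore] -/
theorem contDiffOn_Gmap :
    ContDiffOn ℝ ∞ (𝒥.Gmap hr k) (univ ×ˢ {y : SecPair k r | Small hr k y}) := by
  have hT : ContDiffOn ℝ ∞ (fun p : ℂ × SecPair k r => 𝒥.FT hr k p.2)
      (univ ×ˢ {y : SecPair k r | Small hr k y}) :=
    (𝒥.contDiffOn_FT hr k).comp contDiff_snd.contDiffOn fun p hp => hp.2
  have hN : ContDiffOn ℝ ∞ (fun p : ℂ × SecPair k r => 𝒥.FN hr k p.2)
      (univ ×ˢ {y : SecPair k r | Small hr k y}) :=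
    (𝒥.contDiffOn_FN hr k).comp contDiff_snd.contDiffOn fun p hp => hp.2
  have h3 : ContDiff ℝ ∞ fun p : ℂ × SecPair k r => slice₃ (k + 1) r p.2.1 :=
    (slice₃ (F := ℂ) (k + 1) r).contDiff.comp (contDiff_fst.comp contDiff_snd)
  have h4 : ContDiff ℝ ∞ fun p : ℂ × SecPair k r =>
      eval₀CLM (F := ℂ) (1 : ℂ → ℂ) (k + 1) r 0 p.2.2 - p.1 :=
    ((eval₀CLM (F := ℂ) (1 : ℂ → ℂ) (k + 1) r 0).contDiff.comp
      (contDiff_snd.comp contDiff_snd)).sub contDiff_fst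
  exact (hT.prodMk hN).prodMk (h3.contDiffOn.prodMk h4.contDiffOn)

/-- The derivative of `G` at `(0, 0)`. [folklore] -/
def Gderiv : ℂ × SecPair k r →L[ℝ]
    (holderSections ℂ (dbarClutch (fun w : ℂ => -w ^ 2)) k r ×
      holderSections ℂ (dbarClutch (1 : ℂ → ℂ)) k r) × ((ℂ × ℂ × ℂ) × ℂ) :=
  (((𝒥.LT hr k).comp (ContinuousLinearMap.snd ℝ ℂ (SecPair k r))).prod
      ((𝒥.LN hr k).comp (ContinuousLinearMap.snd ℝ ℂ (SecPair k r)))).prod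
    ((((slice₃ (F := ℂ) (k + 1) r).comp (ContinuousLinearMap.fst ℝ _ _)).comp
        (ContinuousLinearMap.snd ℝ ℂ (SecPair k r))).prod
      (((eval₀CLM (F := ℂ) (1 : ℂ → ℂ) (k + 1) r 0).comp (ContinuousLinearMap.snd ℝ _ _)).comp
          (ContinuousLinearMap.snd ℝ ℂ (SecPair k r)) -
        ContinuousLinearMap.fst ℝ ℂ (SecPair k r)))

/-- Values of `Gderiv`. [folklore] -/
@[simp] theorem Gderiv_apply (p : ℂ × SecPair k r) :
    𝒥.Gderiv hr k p = ((𝒥.LT hr k p.2, 𝒥.LN hr k p.2),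
      (slice₃ (k + 1) r p.2.1, eval₀CLM (F := ℂ) (1 : ℂ → ℂ) (k + 1) r 0 p.2.2 - p.1)) := rfl

/-- **`G` has derivative `Gderiv` at `(0, 0)`.** [cite: Wendl2018, Thm. 2.46] -/
theorem hasFDerivAt_Gmap : HasFDerivAt (𝒥.Gmap hr k) (𝒥.Gderiv hr k) (0, 0) := by
  have hT : HasFDerivAt (fun p : ℂ × SecPair k r => 𝒥.FT hr k p.2)
      ((𝒥.LT hr k).comp (ContinuousLinearMap.snd ℝ ℂ (SecPair k r))) (0, 0) :=
    (show HasFDerivAt (𝒥.FT hr k) (𝒥.LT hr k) (Prod.snd ((0 : ℂ), (0 : SecPair k r))) from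
      𝒥.hasFDerivAt_FT hr k).comp ((0 : ℂ), (0 : SecPair k r)) hasFDerivAt_snd
  have hN : HasFDerivAt (fun p : ℂ × SecPair k r => 𝒥.FN hr k p.2)
      ((𝒥.LN hr k).comp (ContinuousLinearMap.snd ℝ ℂ (SecPair k r))) (0, 0) :=
    (show HasFDerivAt (𝒥.FN hr k) (𝒥.LN hr k) (Prod.snd ((0 : ℂ), (0 : SecPair k r))) from
      𝒥.hasFDerivAt_FN hr k).comp ((0 : ℂ), (0 : SecPair k r)) hasFDerivAt_snd
  have h3 : HasFDerivAt (fun p : ℂ × SecPair k r => slice₃ (k + 1) r p.2.1)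
      (((slice₃ (F := ℂ) (k + 1) r).comp (ContinuousLinearMap.fst ℝ _ _)).comp
        (ContinuousLinearMap.snd ℝ ℂ (SecPair k r))) (0, 0) :=
    (((slice₃ (F := ℂ) (k + 1) r).comp (ContinuousLinearMap.fst ℝ _ _)).comp
      (ContinuousLinearMap.snd ℝ ℂ (SecPair k r))).hasFDerivAt
  have h4 : HasFDerivAt (fun p : ℂ × SecPair k r =>
      eval₀CLM (F := ℂ) (1 : ℂ → ℂ) (k + 1) r 0 p.2.2 - p.1)
      (((eval₀CLM (F := ℂ) (1 : ℂ → ℂ) (k + 1) r 0).comp (ContinuousLinearMap.snd ℝ _ _)).comp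
          (ContinuousLinearMap.snd ℝ ℂ (SecPair k r)) -
        ContinuousLinearMap.fst ℝ ℂ (SecPair k r)) (0, 0) :=
    ((((eval₀CLM (F := ℂ) (1 : ℂ → ℂ) (k + 1) r 0).comp (ContinuousLinearMap.snd ℝ _ _)).comp
      (ContinuousLinearMap.snd ℝ ℂ (SecPair k r))).hasFDerivAt).sub
      (ContinuousLinearMap.fst ℝ ℂ (SecPair k r)).hasFDerivAt
  exact (hT.prodMk hN).prodMk (h3.prodMk h4)

variable {k} in
/-- **The partial derivative of `G` in `y` at `(0, 0)` is the bordered isomorphism `linEquiv`.**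
[cite: Wendl2018, Thm. 2.46] -/
theorem fderiv_Gmap_comp_inr (hr0 : 0 < r) (hr1 : r < 1) (hk : 1 ≤ k) :
    (fderiv ℝ (𝒥.Gmap hr1.le k) (0, 0)).comp (ContinuousLinearMap.inr ℝ ℂ (SecPair k r)) =
      (𝒥.linEquiv hr0 hr1 hk : SecPair k r →L[ℝ] _) := by
  rw [(𝒥.hasFDerivAt_Gmap hr1.le k).fderiv, 𝒥.coe_linEquiv hr0 hr1 hk]
  refine ContinuousLinearMap.ext fun δ => ?_
  simp [Gderiv_apply]

/-! ### The family -/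

variable {k} in
/-- **The implicit-function family of chart solutions** (level `k ≥ 1`): `ε, δ > 0` and a `C^∞` map
`γ : ball 0 ε → SecPair k r` with `γ 0 = 0`, values small and in `ball 0 δ`, solving
`FT (γ a) = 0`, `FN (γ a) = 0`, `slice₃ (γ a).1 = 0`, `(γ a).2 (0) = a`, and unique among small
`y ∈ ball 0 δ` with these properties. [cite: Wendl2018, Thm. 2.46] -/
theorem exists_family (hr0 : 0 < r) (hr1 : r < 1) (hk : 1 ≤ k) :
    ∃ ε > (0 : ℝ), ∃ δ > (0 : ℝ), ∃ γ : ℂ → SecPair k r,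
      ContDiffOn ℝ ∞ γ (ball 0 ε) ∧ γ 0 = 0 ∧ (∀ a ∈ ball (0 : ℂ) ε, γ a ∈ ball (0 : SecPair k r) δ) ∧
      (∀ y ∈ ball (0 : SecPair k r) δ, Small hr1.le k y) ∧
      (∀ a ∈ ball (0 : ℂ) ε, 𝒥.FT hr1.le k (γ a) = 0 ∧ 𝒥.FN hr1.le k (γ a) = 0 ∧
        slice₃ (k + 1) r (γ a).1 = 0 ∧ eval₀CLM (F := ℂ) (1 : ℂ → ℂ) (k + 1) r 0 (γ a).2 = a) ∧
      (∀ a ∈ ball (0 : ℂ) ε, ∀ y ∈ ball (0 : SecPair k r) δ,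
        𝒥.FT hr1.le k y = 0 → 𝒥.FN hr1.le k y = 0 → slice₃ (k + 1) r y.1 = 0 →
          eval₀CLM (F := ℂ) (1 : ℂ → ℂ) (k + 1) r 0 y.2 = a → y = γ a) ∧
      HasFDerivAt γ (-((𝒥.linEquiv hr0 hr1 hk).symm :
          _ →L[ℝ] SecPair k r) ∘L ((fderiv ℝ (𝒥.Gmap hr1.le k) (0, 0)).comp
            (ContinuousLinearMap.inl ℝ ℂ (SecPair k r)))) 0 := by
  have hU : (univ ×ˢ {y : SecPair k r | Small hr1.le k y}) ∈ 𝓝 ((0 : ℂ), (0 : SecPair k r)) :=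
    prod_mem_nhds univ_mem (small_mem_nhds hr1.le k)
  obtain ⟨ε, hε, δ, hδ, γ, hγs, hγ₀, hγδ, hγz, hγu, hsub, hγd⟩ :=
    exists_smooth_implicitFunction_of_contDiffOn' (𝒥.Gmap hr1.le k) 0 0 _ hU
      (𝒥.contDiffOn_Gmap hr1.le k) (𝒥.Gmap_zero hr1.le k) (𝒥.linEquiv hr0 hr1 hk)
      (𝒥.fderiv_Gmap_comp_inr hr0 hr1 hk)
  have hsmall : ∀ y ∈ ball (0 : SecPair k r) δ, Small hr1.le k y := fun y hy => by
    have h : ((0 : ℂ), y) ∈ univ ×ˢ {y : SecPair k r | Small hr1.le k y} :=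
      hsub ⟨mem_ball_self hε, hy⟩
    exact h.2
  have hzero : ∀ (a : ℂ) (y : SecPair k r), 𝒥.Gmap hr1.le k (a, y) = 0 ↔
      (𝒥.FT hr1.le k y = 0 ∧ 𝒥.FN hr1.le k y = 0 ∧ slice₃ (k + 1) r y.1 = 0 ∧
        eval₀CLM (F := ℂ) (1 : ℂ → ℂ) (k + 1) r 0 y.2 = a) := by
    intro a y
    simp only [Gmap, Prod.ext_iff, Prod.fst_zero, Prod.snd_zero, sub_eq_zero]
    tauto
  refine ⟨ε, hε, δ, hδ, γ, hγs, hγ₀, hγδ, hsmall, fun a ha => (hzero a (γ a)).1 (hγz a ha),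
    fun a ha y hy h1 h2 h3 h4 => hγu a ha y hy ((hzero a y).2 ⟨h1, h2, h3, h4⟩), hγd⟩

/-! ### Consequences of `FT y = FN y = 0` for a small `y` -/

variable {hr k}

/-- If `FT y = 0` and `FN y = 0` for a small `y` then both chart outputs vanish:
`out₀ y = 0` and `out₁ y = 0`. [cite: Wendl2018, Thm. 2.46] -/
theorem out_eq_zero_of_FT_FN {y : SecPair k r} (hy : Small hr k y) (hT : 𝒥.FT hr k y = 0)
    (hN : 𝒥.FN hr k y = 0) : 𝒥.out₀ hr k y = 0 ∧ 𝒥.out₁ hr k y = 0 := by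
  have hT' : 𝒥.PT hr k y = 0 := by
    rw [← 𝒥.coe_FT_of_small hy, hT]; rfl
  have hN' : 𝒥.PN hr k y = 0 := by
    rw [← 𝒥.coe_FN_of_small hy, hN]; rfl
  have h1 := congrArg Prod.fst hT'
  have h2 := congrArg Prod.snd hT'
  have h3 := congrArg Prod.fst hN'
  have h4 := congrArg Prod.snd hN'
  constructor
  · refine ContDiffHolderFunction.ext fun z => Prod.ext ?_ ?_
    · have := congrArg (fun u : ContDiffHolderFunction ℂ ℂ k r => u z) h1
      simpa using this
    · have := congrArg (fun u : ContDiffHolderFunction ℂ ℂ k r => u z) h3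
      simpa using this
  · refine ContDiffHolderFunction.ext fun w => Prod.ext ?_ ?_
    · have := congrArg (fun u : ContDiffHolderFunction ℂ ℂ k r => u w) h2
      simpa using this
    · have := congrArg (fun u : ContDiffHolderFunction ℂ ℂ k r => u w) h4
      simpa using this

/-- **A small `y` with `out₀ y = 0` solves the chart-`0` equation on the disc of radius `3`**:
`crOp₀ (sec₀ ξ) (sec₀ f) z = 0` for `‖z‖ < 3`. [cite: Wendl2018, Thm. 2.46] -/
theorem crOp₀_eq_zero_of_out₀ {y : SecPair k r} (hy : Small hr k y) (h : 𝒥.out₀ hr k y = 0)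
    {z : ℂ} (hz : ‖z‖ < 3) :
    𝒥.crOp₀ (sec₀ (fun w : ℂ => -w ^ 2) y.1.1) (sec₀ (1 : ℂ → ℂ) y.2.1) z = 0 := by
  have h1 := congrArg (fun u : ContDiffHolderFunction ℂ (ℂ × ℂ) k r => u z) h
  simp only [ContDiffHolderFunction.coe_zero, Pi.zero_apply] at h1
  rw [𝒥.out₀_apply_of_small hy (hz.trans (by norm_num))] at h1
  exact (smul_eq_zero.1 h1).resolve_left
    (rhoCutBump.pos_of_mem_ball (by simpa [rhoCutBump] using hz)).ne'

/-- **A small `y` with `out₁ y = 0` solves the chart-`1` equation on the disc of radius `3`.**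
[cite: Wendl2018, Thm. 2.46] -/
theorem crOp₁_eq_zero_of_out₁ {y : SecPair k r} (hy : Small hr k y) (h : 𝒥.out₁ hr k y = 0)
    {w : ℂ} (hw : ‖w‖ < 3) :
    𝒥.crOp₁ (sec₁ (fun w : ℂ => -w ^ 2) y.1.1) (sec₁ (1 : ℂ → ℂ) y.2.1) w = 0 := by
  have h1 := congrArg (fun u : ContDiffHolderFunction ℂ (ℂ × ℂ) k r => u w) h
  simp only [ContDiffHolderFunction.coe_zero, Pi.zero_apply] at h1
  rw [𝒥.out₁_apply_of_small hy (hw.trans (by norm_num))] at h1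
  exact (smul_eq_zero.1 h1).resolve_left
    (rhoCutBump.pos_of_mem_ball (by simpa [rhoCutBump] using hw)).ne'

/-- **Where the transport is invertible, vanishing of `crOp₀` is the Cauchy–Riemann equation**:
with `δ` from `exists_pos_isUnit_PhiJet₀`, if `|ξ₀ z|, |f₀ z| < δ` and `‖z‖ ≤ 3` then
`crOp₀ ξ₀ f₀ z = 0` gives `crExpr J₀ (vmap₀ ξ₀ f₀) z = 0`. [cite: Wendl2018, Thm. 2.46] -/
theorem crExpr_eq_zero_of_crOp₀ {δ : ℝ}
    (hδ : ∀ z c t : ℂ, ‖z‖ ≤ 3 → ‖c‖ < δ → ‖t‖ < δ → den z c ≠ 0 ∧ IsUnit (𝒥.PhiJet₀ z c t))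
    {ξ₀ f₀ : ℂ → ℂ} {z : ℂ} (hz : ‖z‖ ≤ 3) (hξ : ‖ξ₀ z‖ < δ) (hf : ‖f₀ z‖ < δ)
    (h : 𝒥.crOp₀ ξ₀ f₀ z = 0) : crExpr 𝒥.J₀ (𝒥.vmap₀ ξ₀ f₀) z = 0 :=
  (𝒥.crOp₀_eq_zero_iff (hδ z _ _ hz hξ hf).2).1 h

/-- The chart-`1` version of `crExpr_eq_zero_of_crOp₀`. [cite: Wendl2018, Thm. 2.46] -/
theorem crExpr_eq_zero_of_crOp₁ {δ : ℝ}
    (hδ : ∀ w c t : ℂ, ‖w‖ ≤ 3 → ‖c‖ < δ → ‖t‖ < δ → den w c ≠ 0 ∧ IsUnit (𝒥.PhiJet₁ w c t))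
    {ξ₁ f₁ : ℂ → ℂ} {w : ℂ} (hw : ‖w‖ ≤ 3) (hξ : ‖ξ₁ w‖ < δ) (hf : ‖f₁ w‖ < δ)
    (h : 𝒥.crOp₁ ξ₁ f₁ w = 0) : crExpr 𝒥.J₁ (𝒥.vmap₁ ξ₁ f₁) w = 0 :=
  (𝒥.crOp₁_eq_zero_iff (hδ w _ _ hw hξ hf).2).1 h

end SphereACData

end SphereCR

end Literature.Geometry.Symplectic

end
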